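import Summits.Ventures.QEC.Census.TwoBGA.TB_l6m24_A0_0_0_1_3_11_B0_0_1_11_5_4.Q144.L1Rows
import Summits.Ventures.QEC.Census.CertBZPlaneAllow
import Summits.Ventures.QEC.Census.CertBZPlaneTop
import HarnessLib

set_option Elab.async false
set_option maxRecDepth 200000

/-!
# `quotient-[[144,12,d_Z≥8]]` one-level cover certificate of `TB_l6m24_A0_0_0_1_3_11_B0_0_1_11_5_4.Q144` — LEVEL-1 list, matrix 1 (depth 2): lane families e1_36_nil … e1_36_nil
(1 families, 667 lanes, 10 straggler visits; est. 4 s kernel; qec-search-1 g5).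
Each family = qec-search-5 `Plane.topOK` (qec-type-01 lane engine) with the top rows `≥ c` FIXED to `P` and `≤ 2 − |P|` free rows
below the cut `c` (a leaf of the adaptive split tree of `L1Tree1*`), STATED against the full level-1 list `eOrb` and PROVED by
`Plane.topOK_mono_allow` from a `decide +kernel` replay against the family's OWN list of met words (a literal `a_<family>`, data),
every such list re-derived in ONE kernel pass per file as a sub-list of `eOrb.filter (· &&& M = V)` — the listed words whose
information pattern on `T_1` has top part `P` (`M` = the columns `T_1[c…35]`, `V` = the columns `T_1[P]`; `<module>_mem`).
Data (allow-lists) + decided checks; tier KERNEL; axioms standard. Generated by qec-search-1 g5 gen/gen_l1.py (generic port of search-9 g6 `gen_l1.py`; pattern of `L1Enum*` p537336 ff.).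
-/

namespace Summit.Ventures.QEC.Census.TB_l6m24_A0_0_0_1_3_11_B0_0_1_11_5_4.Q144

open Summit.Ventures.QEC.Census

/-- The 10 listed words met by family `e1_36_nil` (pattern on `T_1`: top part `[]` above the cut `36`, `≤ 2` bits), ascending; ⊆ `eOrb` by `L1Enum1A_mem*`. -/
def a_e1_36_nil : List ℕ :=
  [0x80021080000101, 0xc0004008084000, 0x100003100000202, 0x200006200000404, 0x40000c400000808, 0x840002004042000, 0xc00001002801000, 0x2000840000004042, 0x40000c0000008084, 0x8000180000010108]

set_option maxHeartbeats 400000000 in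
/-- MEMBERSHIP group 0 (one kernel pass over `eOrb`): the allow-lists of families e1_36_nil … e1_36_nil are contained in
`eOrb.filter (top pattern of the family)` (raw `Nat.land`/`Nat.beq` mask test `w &&& M = V`). -/
theorem L1Enum1A_mem0 :
    ((TB_l6m24_A0_0_0_1_3_11_B0_0_1_11_5_4.Q144.a_e1_36_nil).all fun w => (eOrb.filter fun w => Nat.beq (Nat.land w 0x0) 0x0).elem w) = true := by
  decide +kernel

set_option maxHeartbeats 400000000 in
/-- Matrix 1, cut `c = 36`, top rows `[]`, `≤ 2` free rows below the cut (667 lanes) against the full list `eOrb`: REPLAY against the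
family's own 10-word list (qec-search-5 `topOK`, `decide +kernel`) lifted by CertBZPlaneAllow monotonicity (sub-list by `L1Enum1A_mem*`). -/
theorem e1_36_nil : Plane.topOK 72 6 TB_l6m24_A0_0_0_1_3_11_B0_0_1_11_5_4.Q144.eOrb (giRows eGb eM1) 36 2 0 [] 26 = true :=
  Plane.topOK_mono_allow (allow := a_e1_36_nil)
    (fun w hw => List.mem_of_mem_filter (List.mem_of_elem_eq_true (List.all_eq_true.1 L1Enum1A_mem0 w hw)))
    (by decide +kernel)


end Summit.Ventures.QEC.Census.TB_l6m24_A0_0_0_1_3_11_B0_0_1_11_5_4.Q144
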